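import Literature.NumberTheory.ComplexMultiplication.CMTypeRankBlockConjugation
import Summits.HodgeConjecture.CorCM.ImaginaryQuadraticTimesSimpleCMSurfaceHodge
import Summits.HodgeConjecture.CorCM.ImaginaryQuadraticTimesConjSquareCMHodge
import Summits.HodgeConjecture.CorCM.QuadraticCMFamiliesSeparating
import HarnessLib

/-!
# `E_1^{a_1} × ⋯ × E_r^{a_r} × A^b`: SEVERAL pairwise non-isogenous CM elliptic curves times a CM abelian variety whose CM
# field has complex conjugation a square on its embeddings — the mixed case of the theorem of Imai and Murty

COR-CM (cell `pub-hodgecm2`, seat p2 gen 17, count-neutral claim MULTIQUAD-BLOCK (F2)); NEW as stated, hence under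
`Summits/`.  Theorems only; no definition, no named fact, no `sorry`.

THE POINT.  The tree decides nondegeneracy of a family `(Φ_i)_i` of CM types of CM fields `K_i` — hence `B• = D•` and
the Hodge conjecture on every product `∏_i A_i^{k_i}` of realisations (`Pohlmann1968.CMAlgebra.IsNondegenerateFamily.
hodgeConjectureFor_prod`) — by two mechanisms that do not meet:
(1) PARTIAL CONJUGATIONS slot by slot (`CMTypeRankFamilies.SlotwiseIndependent`, `IndependentCMFieldsHodge`,
`LinearlyDisjointCMFieldsHodge`, `CMTypeRankPartialConjugation` (seat b23), and the two-slot files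
`ImaginaryQuadraticTimes{Cyclic,NonGaloisQuartic,SimpleCMSurface,ConjSquare}CMHodge`): family nondegenerate iff every
member is; (2) ARTIN INDEPENDENCE of sign characters for families of imaginary quadratic fields
(`QuadraticCMFamiliesHodge`, seat lit-deligne-3: separating ⟺ nondegenerate), which needs no partial conjugation and
covers `ℚ(√-1), ℚ(√-2), ℚ(√-3), ℚ(√-6)` (`QuadraticCMFamiliesSeparating.Census1236.not_slotwiseIndependent`).
A family of SEVERAL imaginary quadratic fields `K_j` (`j ≠ i₁`) and ONE further CM field `K_{i₁}` is reached by
neither: no partial conjugation need exist at any slot (`√-6 ∈ ℚ(√-1, √-2, √-3)`, and `K_{i₁}`'s Galois closure may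
contain `√2 ∈ ℚ(√-1, √-2)`), and (2) is about two-element slots only.

Here the two mechanisms are COMPOSED through the block splitting of `CMTypeRankBlockConjugation` (F1): if complex
conjugation on `Hom(K_{i₁}, ℂ)` is the square of an automorphism `τ` of `ℂ`,

> **(□)** `τ ∘ τ ∘ s = s̄` for every `s : K_{i₁} → ℂ`

(the hypothesis of `ImaginaryQuadraticTimesConjSquareCMHodge`; instances: `K_{i₁}` quartic carrying a primitive type —
`QuarticCM.exists_ringAut_smul_smul_eq_conjugate_of_isPrimitive` below —, Galois cyclic of degree `≡ 0 (mod 4)`, Galois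
of degree `8` with nonabelian group), then `σ := τ²` acts as complex conjugation on the slot `i₁` and TRIVIALLY on the two
embeddings of every imaginary quadratic `K_j` (`QuarticCM.smul_smul_eq_self_of_finrank_eq_two`): a block partial
conjugation for the block `{i₁}`.  Hence (`isNondegenerateFamily_iff_of_quadratics_of_smul_smul`)

  `(Φ_i)_i` nondegenerate ⟺ `Φ_{i₁}` nondegenerate ∧ the quadratic sub-family `(Φ_j)_{j ≠ i₁}` is separating,

and (`hodgeConjectureFor_prod_of_quadratics_of_smul_smul`, `…_of_isSimple`, `…_of_sq_eq_neg_of_isSimple`) `B• = D•`,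
no exotic Hodge class, and THE HODGE CONJECTURE hold on every `E_1^{a_1} × ⋯ × E_r^{a_r} × A^b` — every
`⨁_{j<N} A_{π j}` — for pairwise non-isogenous CM elliptic curves `E_j` (a separating family of imaginary quadratic
types, e.g. CM by `ℚ(√-d_j)` with `d_j d_{j'}` non-square) and `A` a realisation of a nondegenerate type of a
(□)-field; in particular for `A` ANY SIMPLE CM ABELIAN SURFACE — unconditionally, no named fact.  This is the CM case of
Moonen–Zarhin's «`Hg(X₁ × ⋯ × X_n × S)`» computations in dimension `≤ 5` ([MoonenZarhin1999LowDim] Cor. (3.9) for the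
curves) extended to ARBITRARY powers and any number of curves, through Deligne's rank ([Deligne1982HodgeCycles] I
Ex. 3.7 (c)) and Gordon's account of Imai–Murty ([Gordon1999HodgeAVSurvey] §3).

CONTENTS. §1 the block splitting at the level of CM fields (`cmFamilyRank_add_one_eq_of_block`,
`isNondegenerateFamily_iff_of_block`: any block `B ⊆ I`, any `σ ∈ Aut(ℂ)` that is complex conjugation on the `Hom(K_i, ℂ)`,
`i ∈ B`, and the identity on the others); §2 the block `{i₁}` under (□) with imaginary quadratic partners
(`cmFamilyRank_add_one_eq_of_quadratics_of_smul_smul`, `isNondegenerateFamily_iff_of_quadratics_of_smul_smul`,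
`isNondegenerateFamily_of_quadratics_of_smul_smul`); §3 geometry (`hodgeClassSpan_prod_eq_divisorClassesSpan_…`,
`not_exists_exceptional_prod_…`, `hodgeConjectureFor_prod_of_quadratics_of_smul_smul`); §4 instances: (□) for quartic
fields with a primitive type, `hodgeConjectureFor_prod_of_quadratics_of_isPrimitive / _of_isSimple /
_of_sq_eq_neg_of_isSimple / _of_card_eq_eight / _of_isCyclic`.

HONEST SCOPE: one non-quadratic slot only (several (□)-slots need partial conjugations AMONG them — seat b23's
`CMTypeRankPartialConjugation` — composed with F1; not done here); the separating hypothesis on the quadratic sub-family is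
the tree's `IsSeparatingFamily` (supplied from generators by `isSeparatingFamily_of_sq_eq_neg`); not a step of
`HC_CM`/`HC_AV`.

## References

* [Gordon1999HodgeAVSurvey] B. B. Gordon, *A survey of the Hodge conjecture for abelian varieties*, §3 Theorem (Imai,
  Murty) with proof; 7.5; 10.10.
* [Deligne1982HodgeCycles] P. Deligne, *Hodge cycles on abelian varieties*, LNM 900 (1982), I Ex. 3.7.
* [MoonenZarhin1999LowDim] B. Moonen, Yu. Zarhin, *Hodge classes on abelian varieties of low dimension*, Math. Ann. 315
  (1999), Cor. (3.9).
* [Shimura1998] G. Shimura, *Abelian Varieties with Complex Multiplication and Modular Functions*, §8.2 Prop. 26,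
  §8.4 (2).
-/

noncomputable section

open CategoryTheory CategoryTheory.Limits NumberField NumberField.ComplexEmbedding IntermediateField
open scoped BigOperators

/-! ## §0 (□) for a quartic CM field carrying a primitive CM type -/

namespace Summit.HodgeConjecture.CorCM.QuarticCM

open Literature.NumberTheory.ComplexMultiplication
open Literature.AlgebraicGeometry.Motives (CMType)
open Literature.AlgebraicGeometry.Pohlmann1968

variable {K : Type} [Field K] [NumberField K] [IsCMField K]

/-- **(□) for every quartic CM field carrying a PRIMITIVE CM type**: complex conjugation on `Hom(K, ℂ)` is the square of
an automorphism of `ℂ` — for `K` Galois the group is cyclic of order `4` (`isCyclic_of_isPrimitive`: biquadratic fields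
carry no primitive type) and `ρ = g²`; for `K` not Galois the `4`-cycle `(a b ā b̄)` of
`exists_ringAut_smul_smul_eq_conjugate`. [cite: Shimura1998, §8.4 (2)] [cite: Lang2002, VI §1 Cor. 1.4] -/
theorem exists_ringAut_smul_smul_eq_conjugate_of_isPrimitive (h4 : Module.finrank ℚ K = 4) {Φ : CMType K}
    {φ₀ : K →+* ℂ} (hprim : IsPrimitive (ℂ ≃+* ℂ) Φ.1 φ₀) :
    ∃ τ : ℂ ≃+* ℂ, ∀ s : K →+* ℂ, τ • τ • s = conjugate s := by
  by_cases hG : IsGalois ℚ K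
  · haveI := isCyclic_of_isPrimitive h4 hprim
    exact ConjSquare.exists_ringAut_smul_smul_eq_conjugate_of_isCyclic (dvd_of_eq h4.symm)
  · exact exists_ringAut_smul_smul_eq_conjugate h4 hG

end Summit.HodgeConjecture.CorCM.QuarticCM

namespace Summit.HodgeConjecture.CorCM

open Literature.NumberTheory.ComplexMultiplication
open Literature.AlgebraicGeometry.Motives (AbelianVariety CMType)
open Literature.AlgebraicGeometry.HodgeTheory
open Literature.AlgebraicGeometry.ComplexMultiplication (IsCMTypeRealisation isSimple_iff_isPrimitive)
open Literature.AlgebraicGeometry.VanGeemen1994 (hodgeClassSpan)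
open Literature.AlgebraicGeometry.Pohlmann1968
open Literature.Barriers.HodgeConjecture (divisorClassesSpan)

/-! ## §1 Block partial conjugations at the level of CM fields -/

section Block

variable {I : Type} {K : I → Type} [∀ i, Field (K i)] [∀ i, NumberField (K i)] [∀ i, IsCMField (K i)] [Fintype I]

omit [∀ i, IsCMField (K i)] in
/-- `|⊔_i Hom(K_i, ℂ)| = Σ_i [K_i : ℚ]`. [folklore] -/
private theorem card_sigma_ringHom_eq_sum :
    Fintype.card ((i : I) × (K i →+* ℂ)) = ∑ i, Module.finrank ℚ (K i) := by
  rw [Fintype.card_sigma]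
  exact Finset.sum_congr rfl fun i _ => Embeddings.card (K i) ℂ

/-- **Rank additivity along a block of CM fields**: if some `σ ∈ Aut(ℂ)` is complex conjugation on `Hom(K_i, ℂ)` for every
`i` in the block `B = {i | p i}` and the identity on `Hom(K_i, ℂ)` for every `i ∉ B` (both blocks nonempty), then
`rank((Φ_i)_{i∈I}) + 1 = rank((Φ_i)_{i∈B}) + rank((Φ_i)_{i∉B})` — on Mumford–Tate groups
`Hg(∏_i A_{Φ_i}) = Hg(∏_{i∈B} A_{Φ_i}) × Hg(∏_{i∉B} A_{Φ_i})` (Imai–Murty's "`Hg(A) = Hg(E_1) × ⋯ × Hg(E_r)`" for the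
two-block decomposition given by one `σ`). [cite: Gordon1999HodgeAVSurvey, §3 Theorem (1)]
[cite: Deligne1982HodgeCycles, I Ex. 3.7 (c) (p. 26)] -/
theorem cmFamilyRank_add_one_eq_of_block (p : I → Prop) {σ : ℂ ≃+* ℂ}
    (hσ : ∀ i, p i → ∀ s : K i →+* ℂ, σ • s = conjugate s) (hσ' : ∀ i, ¬p i → ∀ s : K i →+* ℂ, σ • s = s)
    (hp : ∃ i, p i) (hnp : ∃ i, ¬p i) (Φ : ∀ i, CMType (K i)) :
    CMAlgebra.cmFamilyRank Φ + 1 =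
      CMAlgebra.cmFamilyRank (fun i : {i // p i} => Φ i.1) +
        CMAlgebra.cmFamilyRank (fun i : {i // ¬p i} => Φ i.1) :=
  typeRank_sigmaType_add_one_eq_of_block (G := ℂ ≃+* ℂ) (Φ := fun i => (Φ i).1) p
    (fun i => isCMTypeWith_conj (Φ i)) (fun i hi s => by rw [hσ i hi s, conj_smul_eq_conjugate]) hσ' hp hnp

/-- **Splitting of nondegeneracy along a block of CM fields**: under a block partial conjugation `σ` as above, the family
`(Φ_i)_{i∈I}` is nondegenerate iff BOTH sub-families `(Φ_i)_{i∈B}` and `(Φ_i)_{i∉B}` are (the product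
`∏_{i∈B} A_{Φ_i} × ∏_{i∉B} A_{Φ_i}` is stably nondegenerate iff both factors are; Gordon 7.5 (3)).
[cite: Gordon1999HodgeAVSurvey, §3 Theorem and 7.5] -/
theorem isNondegenerateFamily_iff_of_block (p : I → Prop) [DecidablePred p] {σ : ℂ ≃+* ℂ}
    (hσ : ∀ i, p i → ∀ s : K i →+* ℂ, σ • s = conjugate s) (hσ' : ∀ i, ¬p i → ∀ s : K i →+* ℂ, σ • s = s)
    (hp : ∃ i, p i) (hnp : ∃ i, ¬p i) (Φ : ∀ i, CMType (K i)) :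
    CMAlgebra.IsNondegenerateFamily Φ ↔
      CMAlgebra.IsNondegenerateFamily (fun i : {i // p i} => Φ i.1) ∧
        CMAlgebra.IsNondegenerateFamily (fun i : {i // ¬p i} => Φ i.1) := by
  rw [CMAlgebra.isNondegenerateFamily_iff, CMAlgebra.isNondegenerateFamily_iff, CMAlgebra.isNondegenerateFamily_iff,
    ← card_sigma_ringHom_eq_sum (K := K), ← card_sigma_ringHom_eq_sum (K := fun i : {i // p i} => K i.1),
    ← card_sigma_ringHom_eq_sum (K := fun i : {i // ¬p i} => K i.1)]
  exact typeRank_sigmaType_eq_iff_of_block (G := ℂ ≃+* ℂ) (Φ := fun i => (Φ i).1) p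
    (fun i => isCMTypeWith_conj (Φ i)) (fun i hi s => by rw [hσ i hi s, conj_smul_eq_conjugate]) hσ' hp hnp

end Block

/-! ## §2 One (□)-slot `i₁` and imaginary quadratic partners: `σ = τ²` is a block partial conjugation for `{i₁}` -/

section Quadratics

variable {I : Type} {K : I → Type} [∀ i, Field (K i)] [∀ i, NumberField (K i)] [∀ i, IsCMField (K i)] [Fintype I]
  [DecidableEq I]

omit [Fintype I] [DecidableEq I] in
/-- **`τ²` is a block partial conjugation for the block `{i₁}`**: under (□) it is complex conjugation on
`Hom(K_{i₁}, ℂ)`, and on the two embeddings `{t, t̄}` of each imaginary quadratic `K_j` every automorphism of `ℂ` acts as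
the identity or as conjugation, so its square acts trivially. [cite: Gordon1999HodgeAVSurvey, §3 Theorem (proof)] -/
theorem smul_smul_block (i₁ : I) (h2 : ∀ j, j ≠ i₁ → Module.finrank ℚ (K j) = 2) {τ : ℂ ≃+* ℂ}
    (hτ : ∀ s : K i₁ →+* ℂ, τ • τ • s = conjugate s) :
    (∀ i, i = i₁ → ∀ s : K i →+* ℂ, (τ * τ) • s = conjugate s) ∧
      ∀ i, ¬i = i₁ → ∀ s : K i →+* ℂ, (τ * τ) • s = s := by
  refine ⟨?_, fun i hi s => ?_⟩
  · rintro i rfl s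
    rw [mul_smul]
    exact hτ s
  · rw [mul_smul]
    exact QuarticCM.smul_smul_eq_self_of_finrank_eq_two (h2 i hi) τ s

omit [Fintype I] [DecidableEq I] in
/-- A family indexed by `{i // i = i₁}` is the single type `Φ_{i₁}` (for any `Fintype` structure on the index, taken
implicitly so that it unifies with the ambient one). [cite: Gordon1999HodgeAVSurvey, 7.6.1] -/
private theorem isNondegenerateFamily_subtype_eq_iff (i₁ : I) {inst : Fintype {i // i = i₁}} (Φ : ∀ i, CMType (K i)) :
    @CMAlgebra.IsNondegenerateFamily _ _ _ _ inst (fun i : {i // i = i₁} => Φ i.1) ↔ IsNondegenerate (Φ i₁) := by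
  letI : Unique {i // i = i₁} := ⟨⟨⟨i₁, rfl⟩⟩, fun j => Subtype.ext j.2⟩
  exact @CMAlgebra.isNondegenerateFamily_iff_isNondegenerate _ _ _ _ inst _ _ (fun i : {i // i = i₁} => Φ i.1)

omit [DecidableEq I] in
/-- **Rank additivity for `(K_j)_{j≠i₁}` imaginary quadratic and `K_{i₁}` a (□)-field**:
`rank((Φ_i)_i) + 1 = rank(Φ_{i₁}-block) + rank((Φ_j)_{j≠i₁})`, i.e. `Hg(A × ∏_j E_j) = Hg(A) × Hg(∏_j E_j)`.
[cite: Gordon1999HodgeAVSurvey, §3 Theorem (1)] -/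
theorem cmFamilyRank_add_one_eq_of_quadratics_of_smul_smul (i₁ : I) (h2 : ∀ j, j ≠ i₁ → Module.finrank ℚ (K j) = 2)
    {τ : ℂ ≃+* ℂ} (hτ : ∀ s : K i₁ →+* ℂ, τ • τ • s = conjugate s) (hne : ∃ j, j ≠ i₁) (Φ : ∀ i, CMType (K i)) :
    CMAlgebra.cmFamilyRank Φ + 1 =
      CMAlgebra.cmFamilyRank (fun i : {i // i = i₁} => Φ i.1) +
        CMAlgebra.cmFamilyRank (fun j : {j // j ≠ i₁} => Φ j.1) := by
  obtain ⟨hb, hb'⟩ := smul_smul_block i₁ h2 hτ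
  exact cmFamilyRank_add_one_eq_of_block (fun i => i = i₁) hb hb' ⟨i₁, rfl⟩ hne Φ

/-- **Nondegeneracy criterion for one (□)-slot with imaginary quadratic partners**: the family `(Φ_i)_i` is
nondegenerate iff `Φ_{i₁}` is nondegenerate AND the quadratic sub-family `(Φ_j)_{j≠i₁}` is separating (pairwise
non-isogenous CM elliptic curves — Artin independence of the sign characters, `QuadraticCMFamiliesHodge`; NO partial
conjugation is required among the quadratic slots: `ℚ(√-1), ℚ(√-2), ℚ(√-3), ℚ(√-6)` is allowed).
[cite: Gordon1999HodgeAVSurvey, §3 Theorem and 7.5] [cite: MoonenZarhin1999LowDim, Cor. (3.9)] -/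
theorem isNondegenerateFamily_iff_of_quadratics_of_smul_smul (i₁ : I) (h2 : ∀ j, j ≠ i₁ → Module.finrank ℚ (K j) = 2)
    {τ : ℂ ≃+* ℂ} (hτ : ∀ s : K i₁ →+* ℂ, τ • τ • s = conjugate s) (hne : ∃ j, j ≠ i₁) (Φ : ∀ i, CMType (K i)) :
    CMAlgebra.IsNondegenerateFamily Φ ↔
      IsNondegenerate (Φ i₁) ∧ CMAlgebra.IsSeparatingFamily (fun j : {j // j ≠ i₁} => Φ j.1) := by
  obtain ⟨hb, hb'⟩ := smul_smul_block i₁ h2 hτ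
  rw [isNondegenerateFamily_iff_of_block (fun i => i = i₁) hb hb' ⟨i₁, rfl⟩ hne Φ]
  refine and_congr (isNondegenerateFamily_subtype_eq_iff i₁ Φ) ?_
  obtain ⟨j₀, hj₀⟩ := hne
  haveI : Nonempty {j // j ≠ i₁} := ⟨⟨j₀, hj₀⟩⟩
  exact isNondegenerateFamily_iff_isSeparatingFamily_of_finrank_eq_two (fun j : {j // j ≠ i₁} => h2 j.1 j.2) _

/-- **Sufficiency, without the side condition `∃ j ≠ i₁`** (for `I = {i₁}` the family is the single type `Φ_{i₁}`):
`Φ_{i₁}` nondegenerate and `(Φ_j)_{j≠i₁}` separating ⟹ `(Φ_i)_i` nondegenerate — `A × ∏_j E_j^{k_j}` is stably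
nondegenerate. [cite: Gordon1999HodgeAVSurvey, §3 Theorem and 7.5] [cite: MoonenZarhin1999LowDim, Cor. (3.9)] -/
theorem isNondegenerateFamily_of_quadratics_of_smul_smul (i₁ : I) (h2 : ∀ j, j ≠ i₁ → Module.finrank ℚ (K j) = 2)
    {τ : ℂ ≃+* ℂ} (hτ : ∀ s : K i₁ →+* ℂ, τ • τ • s = conjugate s) {Φ : ∀ i, CMType (K i)}
    (hΦ : IsNondegenerate (Φ i₁)) (hsep : CMAlgebra.IsSeparatingFamily (fun j : {j // j ≠ i₁} => Φ j.1)) :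
    CMAlgebra.IsNondegenerateFamily Φ := by
  by_cases hne : ∃ j, j ≠ i₁
  · exact (isNondegenerateFamily_iff_of_quadratics_of_smul_smul i₁ h2 hτ hne Φ).2 ⟨hΦ, hsep⟩
  · have hall : ∀ j, j = i₁ := fun j => of_not_not fun h => hne ⟨j, h⟩
    letI : Unique I := ⟨⟨i₁⟩, hall⟩
    exact (CMAlgebra.isNondegenerateFamily_iff_isNondegenerate Φ).2 hΦ

end Quadratics

/-! ## §3 Geometry: `B• = D•` and the Hodge conjecture on every `E_1^{a_1} × ⋯ × E_r^{a_r} × A^b` -/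

section Geometry

variable {I : Type} {K : I → Type} [∀ i, Field (K i)] [∀ i, NumberField (K i)] [∀ i, IsCMField (K i)] [Fintype I]
  [DecidableEq I] [Nonempty I] {Φ : ∀ i, CMType (K i)}
variable {A : I → AbelianVariety ℂ} {ι : ∀ i, 𝓞 (K i) →+* End (A i)}
  {θ : ∀ i, K i →+* Module.End ℂ (complexBetti (A i).X 1)}

/-- **`Bᵐ ⊗ ℂ = Dᵐ ⊗ ℂ` on every `E_1^{a_1} × ⋯ × E_r^{a_r} × A^b`** (every `⨁_{j<N} A_{π j}`): `A = A_{i₁}` a realisation of a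
nondegenerate type of a (□)-field `K_{i₁}`, the `E_j = A_j` (`j ≠ i₁`) realisations of a separating family of imaginary
quadratic types. [cite: Gordon1999HodgeAVSurvey, §3 Theorem (2) and 7.5] [cite: MoonenZarhin1999LowDim, Cor. (3.9)] -/
theorem hodgeClassSpan_prod_eq_divisorClassesSpan_of_quadratics_of_smul_smul (i₁ : I)
    (h2 : ∀ j, j ≠ i₁ → Module.finrank ℚ (K j) = 2) {τ : ℂ ≃+* ℂ} (hτ : ∀ s : K i₁ →+* ℂ, τ • τ • s = conjugate s)
    (hΦ : IsNondegenerate (Φ i₁)) (hsep : CMAlgebra.IsSeparatingFamily (fun j : {j // j ≠ i₁} => Φ j.1))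
    (hA : ∀ i, IsCMTypeRealisation (Φ i) (A i) (ι i) (θ i)) {N : ℕ} (π : Fin N → I) (m : ℕ) :
    hodgeClassSpan (⨁ fun j : Fin N => A (π j)).dim (⨁ fun j : Fin N => A (π j)).X m =
      divisorClassesSpan (⨁ fun j : Fin N => A (π j)).X (⨁ fun j : Fin N => A (π j)).dim m :=
  (isNondegenerateFamily_of_quadratics_of_smul_smul i₁ h2 hτ hΦ hsep).hodgeClassSpan_prod_eq_divisorClassesSpan hA π m

/-- **No `E_1^{a_1} × ⋯ × E_r^{a_r} × A^b` as above supports an exotic Hodge class.**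
[cite: Gordon1999HodgeAVSurvey, §3 Theorem (2) and 7.5] -/
theorem not_exists_exceptional_prod_of_quadratics_of_smul_smul (i₁ : I)
    (h2 : ∀ j, j ≠ i₁ → Module.finrank ℚ (K j) = 2) {τ : ℂ ≃+* ℂ} (hτ : ∀ s : K i₁ →+* ℂ, τ • τ • s = conjugate s)
    (hΦ : IsNondegenerate (Φ i₁)) (hsep : CMAlgebra.IsSeparatingFamily (fun j : {j // j ≠ i₁} => Φ j.1))
    (hA : ∀ i, IsCMTypeRealisation (Φ i) (A i) (ι i) (θ i)) {N : ℕ} (π : Fin N → I) (m : ℕ) :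
    ¬∃ c : complexBetti (⨁ fun j : Fin N => A (π j)).X (2 * m), IsRationalClass c ∧
        IsOfHodgeType (⨁ fun j : Fin N => A (π j)).dim (⨁ fun j : Fin N => A (π j)).X (2 * m) m m c ∧
        c ∉ divisorClassesSpan (⨁ fun j : Fin N => A (π j)).X (⨁ fun j : Fin N => A (π j)).dim m :=
  (isNondegenerateFamily_of_quadratics_of_smul_smul i₁ h2 hτ hΦ hsep).not_exists_exceptional_prod hA π m

/-- **The Hodge conjecture for every `E_1^{a_1} × ⋯ × E_r^{a_r} × A^b`** — every `⨁_{j<N} A_{π j}` for a family with ONE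
slot `i₁` realising a NONDEGENERATE CM type of a CM field on whose embeddings complex conjugation is the square of an
automorphism of `ℂ`, and all other slots CM elliptic curves forming a SEPARATING family (pairwise non-isogenous) —
UNCONDITIONAL, no named fact: the mixed case of the theorem of Imai and Murty, through Deligne's rank.
[cite: Gordon1999HodgeAVSurvey, §3 Theorem and 10.10] [cite: MoonenZarhin1999LowDim, Cor. (3.9)] -/
theorem hodgeConjectureFor_prod_of_quadratics_of_smul_smul (i₁ : I) (h2 : ∀ j, j ≠ i₁ → Module.finrank ℚ (K j) = 2)
    {τ : ℂ ≃+* ℂ} (hτ : ∀ s : K i₁ →+* ℂ, τ • τ • s = conjugate s) (hΦ : IsNondegenerate (Φ i₁))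
    (hsep : CMAlgebra.IsSeparatingFamily (fun j : {j // j ≠ i₁} => Φ j.1))
    (hA : ∀ i, IsCMTypeRealisation (Φ i) (A i) (ι i) (θ i)) {N : ℕ} (π : Fin N → I) :
    HodgeConjectureFor (⨁ fun j : Fin N => A (π j)).dim (⨁ fun j : Fin N => A (π j)).X :=
  (isNondegenerateFamily_of_quadratics_of_smul_smul i₁ h2 hτ hΦ hsep).hodgeConjectureFor_prod hA π

/-! ## §4 Instances: a simple CM abelian surface; generators `a_j² = -d_j`; octic and cyclic (□)-fields -/

/-- **The Hodge conjecture for every `E_1^{a_1} × ⋯ × E_r^{a_r} × S^b` with `S` a realisation of a PRIMITIVE type of a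
quartic CM field** and the `E_j` a separating family of CM elliptic curves; unconditional.
[cite: Gordon1999HodgeAVSurvey, §3 Theorem and 10.10] [cite: Shimura1998, §8.4 (2)] -/
theorem hodgeConjectureFor_prod_of_quadratics_of_isPrimitive (i₁ : I) (h2 : ∀ j, j ≠ i₁ → Module.finrank ℚ (K j) = 2)
    (h4 : Module.finrank ℚ (K i₁) = 4) {φ₀ : K i₁ →+* ℂ} (hprim : IsPrimitive (ℂ ≃+* ℂ) (Φ i₁).1 φ₀)
    (hsep : CMAlgebra.IsSeparatingFamily (fun j : {j // j ≠ i₁} => Φ j.1))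
    (hA : ∀ i, IsCMTypeRealisation (Φ i) (A i) (ι i) (θ i)) {N : ℕ} (π : Fin N → I) :
    HodgeConjectureFor (⨁ fun j : Fin N => A (π j)).dim (⨁ fun j : Fin N => A (π j)).X := by
  obtain ⟨τ, hτ⟩ := QuarticCM.exists_ringAut_smul_smul_eq_conjugate_of_isPrimitive h4 hprim
  exact hodgeConjectureFor_prod_of_quadratics_of_smul_smul i₁ h2 hτ (QuarticCM.isNondegenerate_of_isPrimitive h4 _ hprim)
    hsep hA π

/-- **`Bᵐ ⊗ ℂ = Dᵐ ⊗ ℂ` on every `E_1^{a_1} × ⋯ × E_r^{a_r} × S^b` for a SIMPLE CM abelian surface `S`** and pairwise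
non-isogenous CM elliptic curves `E_j` (separating family). [cite: Shimura1998, §8.2 Prop. 26]
[cite: Gordon1999HodgeAVSurvey, §3 Theorem (2) and 7.5] -/
theorem hodgeClassSpan_prod_eq_divisorClassesSpan_of_quadratics_of_isSimple (i₁ : I)
    (h2 : ∀ j, j ≠ i₁ → Module.finrank ℚ (K j) = 2) (h4 : Module.finrank ℚ (K i₁) = 4)
    (hsep : CMAlgebra.IsSeparatingFamily (fun j : {j // j ≠ i₁} => Φ j.1))
    (hA : ∀ i, IsCMTypeRealisation (Φ i) (A i) (ι i) (θ i)) (hS : (A i₁).IsSimple) {N : ℕ} (π : Fin N → I)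
    (m : ℕ) :
    hodgeClassSpan (⨁ fun j : Fin N => A (π j)).dim (⨁ fun j : Fin N => A (π j)).X m =
      divisorClassesSpan (⨁ fun j : Fin N => A (π j)).X (⨁ fun j : Fin N => A (π j)).dim m := by
  obtain ⟨φ₀⟩ : Nonempty (K i₁ →+* ℂ) := inferInstance
  have hprim := (isSimple_iff_isPrimitive (hA i₁) φ₀).1 hS
  obtain ⟨τ, hτ⟩ := QuarticCM.exists_ringAut_smul_smul_eq_conjugate_of_isPrimitive h4 hprim
  exact hodgeClassSpan_prod_eq_divisorClassesSpan_of_quadratics_of_smul_smul i₁ h2 hτ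
    (QuarticCM.isNondegenerate_of_isPrimitive h4 _ hprim) hsep hA π m

/-- **No `E_1^{a_1} × ⋯ × E_r^{a_r} × S^b` with `S` a simple CM abelian surface and the `E_j` pairwise non-isogenous CM
elliptic curves supports an exotic Hodge class.** [cite: Gordon1999HodgeAVSurvey, §3 Theorem (2) and 7.5] -/
theorem not_exists_exceptional_prod_of_quadratics_of_isSimple (i₁ : I)
    (h2 : ∀ j, j ≠ i₁ → Module.finrank ℚ (K j) = 2) (h4 : Module.finrank ℚ (K i₁) = 4)
    (hsep : CMAlgebra.IsSeparatingFamily (fun j : {j // j ≠ i₁} => Φ j.1))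
    (hA : ∀ i, IsCMTypeRealisation (Φ i) (A i) (ι i) (θ i)) (hS : (A i₁).IsSimple) {N : ℕ} (π : Fin N → I)
    (m : ℕ) :
    ¬∃ c : complexBetti (⨁ fun j : Fin N => A (π j)).X (2 * m), IsRationalClass c ∧
        IsOfHodgeType (⨁ fun j : Fin N => A (π j)).dim (⨁ fun j : Fin N => A (π j)).X (2 * m) m m c ∧
        c ∉ divisorClassesSpan (⨁ fun j : Fin N => A (π j)).X (⨁ fun j : Fin N => A (π j)).dim m := by
  obtain ⟨φ₀⟩ : Nonempty (K i₁ →+* ℂ) := inferInstance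
  have hprim := (isSimple_iff_isPrimitive (hA i₁) φ₀).1 hS
  obtain ⟨τ, hτ⟩ := QuarticCM.exists_ringAut_smul_smul_eq_conjugate_of_isPrimitive h4 hprim
  exact not_exists_exceptional_prod_of_quadratics_of_smul_smul i₁ h2 hτ
    (QuarticCM.isNondegenerate_of_isPrimitive h4 _ hprim) hsep hA π m

/-- **The Hodge conjecture for every `E_1^{a_1} × ⋯ × E_r^{a_r} × S^b` with `S` a SIMPLE CM abelian surface (any quartic
CM field, any type) and the `E_j` a separating family of CM elliptic curves** (every `⨁_{j<N} A_{π j}`: `K_{i₁}` quartic,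
`A_{i₁}` simple; `[K_j:ℚ] = 2` for `j ≠ i₁`), UNCONDITIONAL — no named fact.
[cite: Gordon1999HodgeAVSurvey, §3 Theorem and 10.10] [cite: Shimura1998, §8.2 Prop. 26 and §8.4 (2)]
[cite: MoonenZarhin1999LowDim, Cor. (3.9)] -/
theorem hodgeConjectureFor_prod_of_quadratics_of_isSimple (i₁ : I) (h2 : ∀ j, j ≠ i₁ → Module.finrank ℚ (K j) = 2)
    (h4 : Module.finrank ℚ (K i₁) = 4) (hsep : CMAlgebra.IsSeparatingFamily (fun j : {j // j ≠ i₁} => Φ j.1))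
    (hA : ∀ i, IsCMTypeRealisation (Φ i) (A i) (ι i) (θ i)) (hS : (A i₁).IsSimple) {N : ℕ} (π : Fin N → I) :
    HodgeConjectureFor (⨁ fun j : Fin N => A (π j)).dim (⨁ fun j : Fin N => A (π j)).X := by
  obtain ⟨φ₀⟩ : Nonempty (K i₁ →+* ℂ) := inferInstance
  exact hodgeConjectureFor_prod_of_quadratics_of_isPrimitive i₁ h2 h4 ((isSimple_iff_isPrimitive (hA i₁) φ₀).1 hS)
    hsep hA π

/-- **Generators form: the Hodge conjecture for every `E_1^{a_1} × ⋯ × E_r^{a_r} × S^b` with `S` a simple CM abelian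
surface and `E_j` CM elliptic curves with CM by `ℚ(√-d_j) = K_j ∋ a_j`, `a_j² = -d_j`, `d_j d_{j'}` not a square for
`j ≠ j'`** (e.g. `d = 1, 2, 3, 6` and any simple CM surface), UNCONDITIONAL.
[cite: Gordon1999HodgeAVSurvey, §3 Theorem and 10.10] [cite: MoonenZarhin1999LowDim, Cor. (3.9)] -/
theorem hodgeConjectureFor_prod_of_sq_eq_neg_of_isSimple (i₁ : I) (h2 : ∀ j, j ≠ i₁ → Module.finrank ℚ (K j) = 2)
    (h4 : Module.finrank ℚ (K i₁) = 4) {d : I → ℕ} {a : ∀ i, K i} (ha : ∀ j, j ≠ i₁ → a j ^ 2 = -(d j : K j))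
    (hd : ∀ j j', j ≠ i₁ → j' ≠ i₁ → j ≠ j' → ¬IsSquare (d j * d j'))
    (hA : ∀ i, IsCMTypeRealisation (Φ i) (A i) (ι i) (θ i)) (hS : (A i₁).IsSimple) {N : ℕ} (π : Fin N → I) :
    HodgeConjectureFor (⨁ fun j : Fin N => A (π j)).dim (⨁ fun j : Fin N => A (π j)).X :=
  hodgeConjectureFor_prod_of_quadratics_of_isSimple i₁ h2 h4
    (isSeparatingFamily_of_sq_eq_neg (K := fun j : {j // j ≠ i₁} => K j.1) (fun j => h2 j.1 j.2)
      (d := fun j => d j.1) (a := fun j => a j.1) (fun j => ha j.1 j.2)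
      (fun j j' hjj' => hd j.1 j'.1 j.2 j'.2 fun h => hjj' (Subtype.ext h)) fun j => Φ j.1)
    hA hS π

/-- **Octic instance: the Hodge conjecture for every `E_1^{a_1} × ⋯ × E_r^{a_r} × A^b` with `A` a realisation of a
nondegenerate CM type of a GALOIS CM field of degree `8` with NONABELIAN Galois group** (quaternion or dihedral octic CM
fields) and the `E_j` a separating family of CM elliptic curves; unconditional.
[cite: Gordon1999HodgeAVSurvey, §3 Theorem and 10.10] [cite: Lang2002, I §6] -/
theorem hodgeConjectureFor_prod_of_quadratics_of_card_eq_eight (i₁ : I)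
    (h2 : ∀ j, j ≠ i₁ → Module.finrank ℚ (K j) = 2) [IsGalois ℚ (K i₁)] (h8 : Module.finrank ℚ (K i₁) = 8)
    (hG : ∃ a b : K i₁ ≃ₐ[ℚ] K i₁, a * b ≠ b * a) (hΦ : IsNondegenerate (Φ i₁))
    (hsep : CMAlgebra.IsSeparatingFamily (fun j : {j // j ≠ i₁} => Φ j.1))
    (hA : ∀ i, IsCMTypeRealisation (Φ i) (A i) (ι i) (θ i)) {N : ℕ} (π : Fin N → I) :
    HodgeConjectureFor (⨁ fun j : Fin N => A (π j)).dim (⨁ fun j : Fin N => A (π j)).X := by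
  obtain ⟨τ, hτ⟩ := ConjSquare.exists_ringAut_smul_smul_eq_conjugate_of_card_eq_eight h8 hG
  exact hodgeConjectureFor_prod_of_quadratics_of_smul_smul i₁ h2 hτ hΦ hsep hA π

/-- **Cyclic instance: the Hodge conjecture for every `E_1^{a_1} × ⋯ × E_r^{a_r} × A^b` with `A` a realisation of a
nondegenerate CM type of a Galois CM field with CYCLIC group of order `≡ 0 (mod 4)`** (e.g. `ℚ(ζ₅)`, cyclic quartic CM
fields, `ℚ(ζ₁₆)⁺(√-…)`-type fields) and the `E_j` a separating family of CM elliptic curves; unconditional.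
[cite: Gordon1999HodgeAVSurvey, §3 Theorem and 10.10] [cite: Lang2002, VI §1 Cor. 1.4] -/
theorem hodgeConjectureFor_prod_of_quadratics_of_isCyclic (i₁ : I)
    (h2 : ∀ j, j ≠ i₁ → Module.finrank ℚ (K j) = 2) [IsGalois ℚ (K i₁)] [IsCyclic (K i₁ ≃ₐ[ℚ] K i₁)]
    (h4 : 4 ∣ Module.finrank ℚ (K i₁)) (hΦ : IsNondegenerate (Φ i₁))
    (hsep : CMAlgebra.IsSeparatingFamily (fun j : {j // j ≠ i₁} => Φ j.1))
    (hA : ∀ i, IsCMTypeRealisation (Φ i) (A i) (ι i) (θ i)) {N : ℕ} (π : Fin N → I) :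
    HodgeConjectureFor (⨁ fun j : Fin N => A (π j)).dim (⨁ fun j : Fin N => A (π j)).X := by
  obtain ⟨τ, hτ⟩ := ConjSquare.exists_ringAut_smul_smul_eq_conjugate_of_isCyclic (K := K i₁) h4
  exact hodgeConjectureFor_prod_of_quadratics_of_smul_smul i₁ h2 hτ hΦ hsep hA π

end Geometry

end Summit.HodgeConjecture.CorCM

end
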